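import Literature.Geometry.Riemannian.CyclicCoverMetric
import Literature.Geometry.Lorentzian.CurvatureNaturality
import Literature.Geometry.Riemannian.IsotropicCurvature
import HarnessLib

/-!
# Curvature of the lifted metric on the infinite cyclic cover; curvature bounds lift

Continuation of `CyclicCoverMetric.lean`: for the lifted metric `ĝ = proj^* g` on the infinite
cyclic cover `X̂ = CircleMaps.CyclicCover f` of a manifold `X` along `f : X → S¹`, the covering
projection `proj : (X̂, ĝ) → (X, g)` is a local isometry, so all curvature quantities of `ĝ` at
`x̂` are those of `g` at `proj x̂` read through `dproj` (O'Neill 1983, Ch. 3, Prop. 3.59 and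
Cor. 3.60–3.61: local isometries preserve the Levi-Civita connection and the curvature; the tree's
`riemann_comap_apply`, `ricci_comap_apply`, `scalarCurvature_comap` of `CurvatureNaturality.lean`;
the Levi-Civita connection of the unfolded pull-back `g.comap … proj …` exists outright by
`PseudoRiemannianMetric.hasLeviCivita` of `LeviCivitaProofs.lean`):

* `riemann_liftMetric`, `curvatureForm_liftMetric`, `ricci_liftMetric`,
  `scalarCurvature_liftMetric`;
* `sec_liftMetric_ge_of_sec_ge`, `ricci_liftMetric_ge_of_ricci_ge` — **lower curvature bounds
  lift to the cover**: `sec_g ≥ -κ` (in the Gram form `-κ (g(X,X) g(Y,Y) - g(X,Y)²) ≤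
  Rm(X,Y,Y,X)`) and `Ric_g ≥ -δ g` on `X` imply the same bounds for `ĝ` on `X̂`. These are the
  hypotheses `Ric ≥ -εᵢ`, `sec ≥ -1` carried by the covers `M̂ᵢ` in Huang–Huang–Wang–Zhu 2026,
  §4 (p. 13), where the geometry is done.

Everything is proved; no definitions, no named facts.

## References

* B. O'Neill, *Semi-Riemannian Geometry with Applications to Relativity* (1983), Ch. 3,
  Prop. 3.59, Cor. 3.60–3.61, pp. 90–91; Ch. 7, p. 192. [ONeill1983]
* H. Huang, X.-T. Huang, J. Wang, X. Zhu, arXiv:2605.24380 (2026), §4, p. 13. [HuangHuangWangZhu2026]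
-/

noncomputable section

open scoped Manifold ContDiff Topology
open Function Set

namespace Literature.Geometry.Riemannian

open Literature.Geometry.Lorentzian Literature.Geometry.Lorentzian.PseudoRiemannianMetric
  Literature.Geometry.Manifold Literature.Topology.FourManifolds.CircleMaps
  Literature.Topology.FourManifolds.CircleMaps.CyclicCover

variable {E : Type*} [NormedAddCommGroup E] [NormedSpace ℝ E]
  {H : Type*} [TopologicalSpace H] {I : ModelWithCorners ℝ E H}
  {X : Type*} [TopologicalSpace X] [ChartedSpace H X] [IsManifold I ∞ X]
  [FiniteDimensional ℝ E] [CompleteSpace E]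
  (f : C(X, Circle)) (g : PseudoRiemannianMetric I ∞ E (TangentSpace I : X → Type _))
  [g.HasLeviCivita] [(liftMetric f g).HasLeviCivita]

omit [CompleteSpace E] [g.HasLeviCivita] [(liftMetric f g).HasLeviCivita] in
/-- `dproj ((dproj)⁻¹ w) = w` for the inverse differential of the covering projection.
[folklore] -/
theorem mfderiv_proj_inverse_apply (e : CyclicCover f) (w : TangentSpace I (proj e)) :
    mfderiv I I (proj : CyclicCover f → X) e ((mfderiv I I (proj : CyclicCover f → X) e).inverse w)
      = w := by
  rw [inverse_mfderiv_apply (I := I) (I' := I) rfl (injective_mfderiv_cyclicCover_proj f e),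
    mfderiv_mfderivEquivOfInjective_symm]

/-- **The Riemann tensor of the lifted metric**: `R̂_x̂(X, Y) Z = (dproj)⁻¹ R_{proj x̂}(dproj X,
dproj Y) dproj Z` (O'Neill 1983, Ch. 3, Prop. 3.59, for the local isometry `proj`).
[cite: ONeill1983, Ch. 3, Prop. 3.59] -/
theorem riemann_liftMetric (e : CyclicCover f) (X₀ Y₀ Z₀ : TangentSpace I e) :
    (liftMetric f g).riemann e X₀ Y₀ Z₀ =
      (mfderiv I I (proj : CyclicCover f → X) e).inverse
        (g.riemann (proj e) (mfderiv I I (proj : CyclicCover f → X) e X₀)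
          (mfderiv I I (proj : CyclicCover f → X) e Y₀)
          (mfderiv I I (proj : CyclicCover f → X) e Z₀)) := by
  haveI := (g.comap contMDiff_pullbackBilin_holds (proj : CyclicCover f → X)
    (contMDiff_cyclicCover_proj_succ f) (injective_mfderiv_cyclicCover_proj f) rfl).hasLeviCivita
  exact riemann_comap_apply g contMDiff_pullbackBilin_holds (contMDiff_cyclicCover_proj_succ f)
    (injective_mfderiv_cyclicCover_proj f) rfl e X₀ Y₀ Z₀

/-- **The covariant curvature tensor of the lifted metric**:
`R̂m_x̂(X, Y, Z, W) = Rm_{proj x̂}(dproj X, dproj Y, dproj Z, dproj W)`.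
[cite: ONeill1983, Ch. 3, Prop. 3.59] -/
theorem curvatureForm_liftMetric (e : CyclicCover f) (X₀ Y₀ Z₀ W₀ : TangentSpace I e) :
    (liftMetric f g).curvatureForm (liftMetric f g).leviCivita e X₀ Y₀ Z₀ W₀ =
      g.curvatureForm g.leviCivita (proj e) (mfderiv I I (proj : CyclicCover f → X) e X₀)
        (mfderiv I I (proj : CyclicCover f → X) e Y₀)
        (mfderiv I I (proj : CyclicCover f → X) e Z₀)
        (mfderiv I I (proj : CyclicCover f → X) e W₀) := by
  show (liftMetric f g).val e ((liftMetric f g).riemann e X₀ Y₀ Z₀) W₀ =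
    g.val (proj e) (g.riemann (proj e) _ _ _) _
  rw [riemann_liftMetric, liftMetric_apply, mfderiv_proj_inverse_apply]

/-- **The Ricci tensor of the lifted metric**: `R̂ic_x̂(Y, Z) = Ric_{proj x̂}(dproj Y, dproj Z)`.
[cite: ONeill1983, Ch. 3, Prop. 3.59] -/
theorem ricci_liftMetric (e : CyclicCover f) (Y₀ Z₀ : TangentSpace I e) :
    (liftMetric f g).ricci e Y₀ Z₀ =
      g.ricci (proj e) (mfderiv I I (proj : CyclicCover f → X) e Y₀)
        (mfderiv I I (proj : CyclicCover f → X) e Z₀) := by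
  haveI := (g.comap contMDiff_pullbackBilin_holds (proj : CyclicCover f → X)
    (contMDiff_cyclicCover_proj_succ f) (injective_mfderiv_cyclicCover_proj f) rfl).hasLeviCivita
  exact ricci_comap_apply g contMDiff_pullbackBilin_holds (contMDiff_cyclicCover_proj_succ f)
    (injective_mfderiv_cyclicCover_proj f) rfl e Y₀ Z₀

/-- **The scalar curvature of the lifted metric**: `Ŝ(x̂) = S(proj x̂)`.
[cite: ONeill1983, Ch. 3, Prop. 3.59] -/
theorem scalarCurvature_liftMetric (e : CyclicCover f) :
    (liftMetric f g).scalarCurvature e = g.scalarCurvature (proj e) := by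
  haveI := (g.comap contMDiff_pullbackBilin_holds (proj : CyclicCover f → X)
    (contMDiff_cyclicCover_proj_succ f) (injective_mfderiv_cyclicCover_proj f) rfl).hasLeviCivita
  exact scalarCurvature_comap g contMDiff_pullbackBilin_holds (contMDiff_cyclicCover_proj_succ f)
    (injective_mfderiv_cyclicCover_proj f) rfl e

/-- **Lower sectional curvature bounds lift to the cover**: if `sec_g ≥ -κ` on `X` in the Gram
form `-κ (g(X,X) g(Y,Y) - g(X,Y)²) ≤ Rm(X, Y, Y, X)`, then the lifted metric satisfies the same
inequality on `X̂` (the bound `sec ≥ -1` of the covers `M̂ᵢ` in Huang–Huang–Wang–Zhu 2026, §4).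
[cite: ONeill1983, Ch. 3, Cor. 3.61] -/
theorem sec_liftMetric_ge_of_sec_ge {κ : ℝ}
    (hsec : ∀ (x : X) (X₀ Y₀ : TangentSpace I x),
      -κ * (g.val x X₀ X₀ * g.val x Y₀ Y₀ - g.val x X₀ Y₀ ^ 2) ≤
        g.curvatureForm g.leviCivita x X₀ Y₀ Y₀ X₀)
    (e : CyclicCover f) (X₀ Y₀ : TangentSpace I e) :
    -κ * ((liftMetric f g).val e X₀ X₀ * (liftMetric f g).val e Y₀ Y₀ -
        (liftMetric f g).val e X₀ Y₀ ^ 2) ≤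
      (liftMetric f g).curvatureForm (liftMetric f g).leviCivita e X₀ Y₀ Y₀ X₀ := by
  rw [curvatureForm_liftMetric, liftMetric_apply, liftMetric_apply, liftMetric_apply]
  exact hsec (proj e) _ _

/-- **Lower Ricci bounds lift to the cover**: if `Ric_g ≥ -δ g` on `X` then `R̂ic ≥ -δ ĝ` on
`X̂` (the bound `Ric ≥ -εᵢ` of the covers `M̂ᵢ` in Huang–Huang–Wang–Zhu 2026, §4).
[cite: ONeill1983, Ch. 3, Prop. 3.59] -/
theorem ricci_liftMetric_ge_of_ricci_ge {δ : ℝ}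
    (hric : ∀ (x : X) (w : TangentSpace I x), -δ * g.val x w w ≤ g.ricci x w w)
    (e : CyclicCover f) (w : TangentSpace I e) :
    -δ * (liftMetric f g).val e w w ≤ (liftMetric f g).ricci e w w := by
  rw [ricci_liftMetric, liftMetric_apply]
  exact hric (proj e) _

end Literature.Geometry.Riemannian
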